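/-
Origin: expansion seat `planner-pub-hodgecm-pv08-0`, handover 2026-08-18T03:43:36Z (missed at run 19) / 03:56:56Z (`HOME/pub-hodgecm-pv08/lean/Pv08/AllowedData.lean`, md5 f0396fab, 189 lines);
landed by the gen-5 packager in gate run 20 as `HodgeCM/PerL34/AllowedData.lean` (verbatim).
-/
/-
Origin: HOME/pub-hodgecm-pv08/lean/Pv08/AllowedData.lean — session planner-pub-hodgecm-pv08-0 (unit pub-hodgecm-pv08,
DAG-NODE PROVER #08).  Intended final place: `HodgeCM/PerL34/AllowedData.lean`.  DAG node: **N11** = PerL v5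
Definition 3.2 (`def:allowed`), tex ll. 269–279 — a DEFINITION node.  The package renders Def 3.2 as DATA
(`SeesawCtx.D` = the four lines, `TorusData.X`/`allowed` = the pair characters and the opaque allowedness
predicate, `GoodCtx.pairSum`; the splitting characters μ_i, μ_W are not modelled at all — see HOME/GAPS.md
`### pv08/N11` for the clause-by-clause audit).  This file kernel-checks the definition's INTERNAL CONSISTENCY
claims — the two "i.e." / "equivalently" clauses of ll. 270–272 and the parity compatibility between the
prescribed infinity types and the prescribed restrictions to `𝔸×_{L₀}` (used at tex ll. 305–307) — in the live
vocabulary `CMType`, `HodgeCM.ind`, `HodgeCM.PairSum`.  Pure Mathlib + `HodgeCM.CM.Basic/Lemmas`; nothing posited.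
-/
import Summits.HodgeConjecture.HodgeCM.CM.Lemmas

set_option autoImplicit false

/-!
# PerL v5 Definition 3.2 (DAG node N11): allowed data — the archimedean bookkeeping, kernel-checked

Verbatim (tex ll. 270–277): "Fix a unitary Hecke character `\mu_W` of `L` with `\mu_W|_{\A^\times_{L_0}}=1` whose
infinity type is that of `\mu\mu'` for `\mu,\mu'` of CM types `\Psi_1,\Psi_2` (equivalently `\Psi_3,\Psi_4`,
Remark~\ref{rem:tetra}); i.e.\ `\mu_W\|\cdot\|^{-1}` is algebraic of infinity type `-\mathbf 1_{\Psi_1}-\mathbf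
1_{\Psi_2}`. An \emph{allowed datum of type `\Psi_i`} is a triple `(W_i,\mu_i,\chi'_i)`: a hermitian line
`W_i=(L,a_ix\bar y)`, a splitting character `\mu_i` (`\mu_i|=\varepsilon_{L/L_0}`) with `\mu_i\|\cdot\|^{-1/2}`
algebraic of infinity type `-\sum_{\rho\in\Psi_i}\rho`, and an automorphic character `\chi'_i` of `[\U(W_i)]=[\U(1)]`,
such that the theta space `\pi_i:=\Theta^{W_i}_{\mu_i}(\chi'_i)` is non-zero and every irreducible constituent of its
`L^2`-closure lies in `\cA^{1,0}`. An \emph{allowed pair of type `(12)`} is a pair of allowed data of types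
`\Psi_1,\Psi_2` with `\mu_1\mu_2=\mu_W`; likewise for `(34)` with `\mu_3\mu_4=\mu_W`."

## Dictionary (exponent coordinates at one conjugate pair `{φ, φ̄}` of complex embeddings)

A unitary character of `ℂ^×` trivial on `ℝ_{>0}` is `z ↦ (z/|z|)^m`, `m ∈ ℤ` (tex l. 306: "prescribed components
`(z/|z|)^{m_b}` at the complex places").  "`μ‖·‖^{-1/2}` algebraic of infinity type `-\sum_{ρ∈Ψ}ρ`" reads, at the
pair `{φ, φ̄}` (idelic norm `‖z‖ = |z|²` at a complex place, so `‖·‖^{-1/2} = |z|^{-1}`): `(z/|z|)^m |z|^{-1} =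
z^p \bar z^q` with `(p,q) = (-\mathrm{ind}_Ψ(φ), -\mathrm{ind}_Ψ(φ̄)) = (-\mathrm{ind}_Ψ(φ), \mathrm{ind}_Ψ(φ) - 1)`,
whence `m = p - q = 1 - 2·\mathrm{ind}_Ψ(φ)` (`= -1` if `φ ∈ Ψ`, `+1` if `φ̄ ∈ Ψ`; this is `Perl34.C3a.mOf` of
the prior vocabulary and (eq:Phiprime), tex ll. 98–100).  Products of characters add exponents.
-/

noncomputable section

namespace HodgeCM
namespace PerL34
namespace AllowedData

open Literature.AlgebraicGeometry.Motives (CMType)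

variable {K : Type} [Field K]

/-- The archimedean exponent `m_φ(μ)` of a splitting character `μ` "of CM type `Ψ`" (Def 3.2, l. 273–274:
`μ‖·‖^{-1/2}` algebraic of infinity type `-\sum_{ρ∈Ψ}ρ`) at the embedding `φ`: `1 - 2·ind_Ψ(φ)`. -/
def muExp (Ψ : CMType K) (φ : K →+* ℂ) : ℤ := 1 - 2 * ind Ψ φ

/-- The exponent of `μ_W` prescribed through the pair `(Ψ₁, Ψ₂)` (l. 270–271: "infinity type that of `μμ'` for
`μ, μ'` of CM types `Ψ_1, Ψ_2`"): exponents add under products of characters. -/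
def muWExp12 (Ψ : Fin 4 → CMType K) (φ : K →+* ℂ) : ℤ := muExp (Ψ 0) φ + muExp (Ψ 1) φ

/-- The exponent of `μ_W` prescribed through the pair `(Ψ₃, Ψ₄)` (l. 271: "equivalently `Ψ_3, Ψ_4`"). -/
def muWExp34 (Ψ : Fin 4 → CMType K) (φ : K →+* ℂ) : ℤ := muExp (Ψ 2) φ + muExp (Ψ 3) φ

/-- The exponent of `μ_W‖·‖^{-1}` read from "algebraic of infinity type `-\mathbf 1_{Ψ_1}-\mathbf 1_{Ψ_2}`" (l. 271–272):
`(p,q) = (-(ind_{Ψ₁}+ind_{Ψ₂})(φ), -(ind_{Ψ₁}+ind_{Ψ₂})(φ̄))` and `m = p - q`; with `ind_Ψ(φ̄) = 1 - ind_Ψ(φ)` this is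
`2 - 2(ind_{Ψ₁}(φ) + ind_{Ψ₂}(φ))`. -/
def muWExpIe (Ψ : Fin 4 → CMType K) (φ : K →+* ℂ) : ℤ := 2 - 2 * (ind (Ψ 0) φ + ind (Ψ 1) φ)

/-- `ind_Ψ(φ̄) = 1 - ind_Ψ(φ)`: a CM type contains exactly one of `φ, φ̄` (also `HodgeCM.ind_conjugate` in
`Proofs/RealisationConstruction.lean`; re-proved here to keep the import light). -/
theorem ind_conjugate_eq (Ψ : CMType K) (φ : K →+* ℂ) :
    ind Ψ (NumberField.ComplexEmbedding.conjugate φ) = 1 - ind Ψ φ := by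
  by_cases hφ : φ ∈ Ψ.1
  · rw [ind_of_mem hφ, ind_of_not_mem ((Ψ.2 φ).1 hφ)]; norm_num
  · have hc : NumberField.ComplexEmbedding.conjugate φ ∈ Ψ.1 := by
      by_contra hc; exact hφ ((Ψ.2 φ).2 hc)
    rw [ind_of_not_mem hφ, ind_of_mem hc]; norm_num

/-- The exponent of a splitting character of CM type is `-1` at `φ ∈ Ψ` … -/
theorem muExp_of_mem {Ψ : CMType K} {φ : K →+* ℂ} (h : φ ∈ Ψ.1) : muExp Ψ φ = -1 := by
  unfold muExp; rw [ind_of_mem h]; norm_num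

/-- … and `+1` at `φ ∉ Ψ` (i.e. `φ̄ ∈ Ψ`) — (eq:Phiprime), tex ll. 98–100, and `Perl34.C3a.mOf`. -/
theorem muExp_of_not_mem {Ψ : CMType K} {φ : K →+* ℂ} (h : φ ∉ Ψ.1) : muExp Ψ φ = 1 := by
  unfold muExp; rw [ind_of_not_mem h]; norm_num

/-- (Ported verbatim from the HodgeCMPerL package; no docstring in the source.) -/
theorem muExp_odd (Ψ : CMType K) (φ : K →+* ℂ) : Odd (muExp Ψ φ) := by
  by_cases h : φ ∈ Ψ.1
  · rw [muExp_of_mem h]; decide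
  · rw [muExp_of_not_mem h]; decide

/-- The exponent read DIRECTLY from "`μ‖·‖^{-1/2}` of infinity type `-\sum_{ρ∈Ψ}ρ`" as `p - q` with
`(p, q) = (-ind_Ψ(φ), -ind_Ψ(φ̄))` agrees with `muExp` (the dictionary of the module docstring, checked). -/
theorem muExp_eq_p_sub_q (Ψ : CMType K) (φ : K →+* ℂ) :
    muExp Ψ φ = (-ind Ψ φ) - (-ind Ψ (NumberField.ComplexEmbedding.conjugate φ)) := by
  rw [ind_conjugate_eq]; unfold muExp; ring

/-- **"i.e." clause of l. 271–272**: the exponent of `μ_W` computed as "type of `μμ'`, `μ, μ'` of CM types `Ψ₁, Ψ₂`"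
equals the one read from "`μ_W‖·‖^{-1}` algebraic of infinity type `-\mathbf 1_{Ψ_1}-\mathbf 1_{Ψ_2}`" — identically,
no hypothesis. -/
theorem muWExp12_eq_ie (Ψ : Fin 4 → CMType K) (φ : K →+* ℂ) : muWExp12 Ψ φ = muWExpIe Ψ φ := by
  unfold muWExp12 muWExpIe muExp; ring

/-- `muWExpIe` is indeed `p - q` for `(p,q) = (-(ind_{Ψ₁}+ind_{Ψ₂})(φ), -(ind_{Ψ₁}+ind_{Ψ₂})(φ̄))`. -/
theorem muWExpIe_eq_p_sub_q (Ψ : Fin 4 → CMType K) (φ : K →+* ℂ) :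
    muWExpIe Ψ φ = (-(ind (Ψ 0) φ + ind (Ψ 1) φ)) -
      (-(ind (Ψ 0) (NumberField.ComplexEmbedding.conjugate φ) +
        ind (Ψ 1) (NumberField.ComplexEmbedding.conjugate φ))) := by
  rw [ind_conjugate_eq, ind_conjugate_eq]; unfold muWExpIe; ring

/-- **"equivalently `Ψ₃, Ψ₄` (Remark tetra)" clause of l. 271**: the two prescriptions of `μ_W`'s infinity type,
through `(Ψ₁,Ψ₂)` and through `(Ψ₃,Ψ₄)`, coincide at every embedding IF AND ONLY IF the pair-sum identity
`\mathbf 1_{Ψ_1}+\mathbf 1_{Ψ_2}=\mathbf 1_{Ψ_3}+\mathbf 1_{Ψ_4}` holds (`HodgeCM.PairSum`, = `GoodCtx.pairSum` of the theta model).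
So ONE `μ_W` can serve both the (12) and the (34) allowed pairs exactly under rem:tetra — the well-definedness
content of Def 3.2 (and the reason `μ₁μ₂ = μ₃μ₄ = μ_W` is satisfiable, tex l. 305). -/
theorem muWExp12_eq_muWExp34_iff_pairSum (Ψ : Fin 4 → CMType K) :
    (∀ φ, muWExp12 Ψ φ = muWExp34 Ψ φ) ↔ PairSum Ψ := by
  unfold muWExp12 muWExp34 muExp PairSum
  constructor
  · intro h φ; have := h φ; omega
  · intro h φ; have := h φ; omega

/-- The `μ_W` exponents are EVEN, the `μ_i` exponents ODD — "all `m_b ≡ m mod 2`" of tex l. 307 with `m = 0` for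
`μ_W` (restriction `1 = ε^0`) and `m = 1` for `μ_i` (restriction `ε_{L/L_0}`). -/
theorem muWExp12_even (Ψ : Fin 4 → CMType K) (φ : K →+* ℂ) : Even (muWExp12 Ψ φ) := by
  unfold muWExp12
  exact (muExp_odd (Ψ 0) φ).add_odd (muExp_odd (Ψ 1) φ)

/-- The `μ_W` exponent lies in `{-2, 0, 2}`. -/
theorem muWExp12_mem (Ψ : Fin 4 → CMType K) (φ : K →+* ℂ) :
    muWExp12 Ψ φ = -2 ∨ muWExp12 Ψ φ = 0 ∨ muWExp12 Ψ φ = 2 := by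
  unfold muWExp12
  by_cases h0 : φ ∈ (Ψ 0).1 <;> by_cases h1 : φ ∈ (Ψ 1).1 <;>
    simp [muExp_of_mem, muExp_of_not_mem, h0, h1]

/-! ## Parity compatibility with the prescribed restrictions to `𝔸×_{L₀}` (tex ll. 270, 273, 305–307)

At a real place `b` of `L₀` (complex in `L`) the archimedean component `z ↦ (z/|z|)^{m_b}` restricted to
`L_{0,b}^× = ℝ^×` is `x ↦ \mathrm{sgn}(x)^{m_b}`: trivial when `m_b` is even (consistent with `μ_W|_{\A^×_{L_0}} = 1`),
the sign character when `m_b` is odd (consistent with `μ_i| = ε_{L/L_0}`, whose component at a real place of `L₀`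
that becomes complex in `L` is the sign character).  This is the sentence "the two prescriptions agree on
`L^×_∞ ∩ \A^×_{L_0} = L^×_{0,∞}`" of l. 307–308, archimedean half. -/

/-- The unitary part `z/|z|` of a complex number. -/
def unitPart (z : ℂ) : ℂ := z / (‖z‖ : ℂ)

/-- The sign of a real number as a complex number (`-1` for negatives, `1` otherwise; used only at `x ≠ 0`). -/
def rsgn (x : ℝ) : ℂ := if x < 0 then -1 else 1

/-- (Ported verbatim from the HodgeCMPerL package; no docstring in the source.) -/
theorem unitPart_ofReal {x : ℝ} (hx : x ≠ 0) : unitPart (x : ℂ) = rsgn x := by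
  unfold unitPart rsgn
  have hx' : ((x : ℝ) : ℂ) ≠ 0 := by exact_mod_cast hx
  rw [Complex.norm_real, Real.norm_eq_abs]
  rcases lt_or_gt_of_ne hx with h | h
  · rw [if_pos h, abs_of_neg h]; push_cast; field_simp
  · rw [if_neg (not_lt.2 h.le), abs_of_pos h]; field_simp

/-- (Ported verbatim from the HodgeCMPerL package; no docstring in the source.) -/
theorem rsgn_sq (x : ℝ) : rsgn x ^ 2 = 1 := by
  unfold rsgn; split_ifs <;> norm_num

/-- (Ported verbatim from the HodgeCMPerL package; no docstring in the source.) -/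
theorem rsgn_ne_zero (x : ℝ) : rsgn x ≠ 0 := by
  unfold rsgn; split_ifs <;> norm_num

/-- Even exponent: `(x/|x|)^m = 1` on `ℝ^×` — the `μ_W` case (`μ_W|_{\A^×_{L_0}} = 1`, l. 270). -/
theorem unitPart_ofReal_zpow_even {x : ℝ} (hx : x ≠ 0) {m : ℤ} (hm : Even m) :
    unitPart (x : ℂ) ^ m = 1 := by
  obtain ⟨k, rfl⟩ := hm
  rw [unitPart_ofReal hx, ← two_mul, zpow_mul, zpow_ofNat, rsgn_sq, one_zpow]

/-- Odd exponent: `(x/|x|)^m = \mathrm{sgn}(x)` on `ℝ^×` — the `μ_i` case (`μ_i| = ε_{L/L_0}`, l. 273). -/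
theorem unitPart_ofReal_zpow_odd {x : ℝ} (hx : x ≠ 0) {m : ℤ} (hm : Odd m) :
    unitPart (x : ℂ) ^ m = rsgn x := by
  obtain ⟨k, rfl⟩ := hm
  rw [unitPart_ofReal hx, zpow_add₀ (rsgn_ne_zero x), zpow_mul, zpow_ofNat, rsgn_sq, one_zpow, one_mul,
    zpow_one]

/-- **Def 3.2's archimedean restriction compatibility, (12)-prescribed `μ_W`**: at every real place the prescribed
component of `μ_W` is trivial on `ℝ^×`. -/
theorem muW_component_trivial_on_reals (Ψ : Fin 4 → CMType K) (φ : K →+* ℂ) {x : ℝ} (hx : x ≠ 0) :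
    unitPart (x : ℂ) ^ (muWExp12 Ψ φ) = 1 :=
  unitPart_ofReal_zpow_even hx (muWExp12_even Ψ φ)

/-- **Def 3.2's archimedean restriction compatibility, `μ_i`**: at every real place the prescribed component of
`μ_i` restricts to the sign character of `ℝ^×` (= the local component of `ε_{L/L_0}` there). -/
theorem mu_component_sign_on_reals (Ψ : CMType K) (φ : K →+* ℂ) {x : ℝ} (hx : x ≠ 0) :
    unitPart (x : ℂ) ^ (muExp Ψ φ) = rsgn x :=
  unitPart_ofReal_zpow_odd hx (muExp_odd Ψ φ)

end AllowedData
end PerL34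
end HodgeCM

end
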